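import Summits.ResolutionOfSingularities.ResolutionOfSingularities.Theorems.EquisingularLiftEquisingularLiftNatNDStrataTower
import Summits.ResolutionOfSingularities.ResolutionOfSingularities.Theorems.EquisingularLiftCampaignW45bULTHorizontalBridge
import Literature.AlgebraicGeometry.Resolution.MarkedIdealsEtale
import Literature.AlgebraicGeometry.Resolution.StrictTransformBaseChange
import Literature.AlgebraicGeometry.Resolution.BlowupsProperProofs
import Mathlib.AlgebraicGeometry.Morphisms.UniversallyOpen
import HarnessLib

/-!
# [OURS · L1 W4.5(b) · EL♮(3) · ND-K5 (B4β1)] STRATA TOWERS UNDER FLAT BASE CHANGE — `…NatNDStrataTowerBaseChange`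

OURS · L1 W4.5(b) · EL♮(3) stmt-ResolutionOfSingularities-20148 (parent EL♮ stmt-…-20038) · counted 0 · AI-written (res-L1-w45b-nose-w2 g0, WIDTH seat on
D-0157 DOOR 1; desk WIDTH TABLE D1′ row nose-w2 = (B4β1)), weaker than expert review; nothing of [Hironaka2017] asserted; no statement of the manuscript; resolution
in positive characteristic is NOT proved here or anywhere in this cell. PROVED pure plumbing (no `sorry`, no new definition, no instance, no notation; standard axioms).
`--supports stmt-ResolutionOfSingularities-20148 --as helper`.

WHAT. The infrastructure lemma (B4β1) behind the étale/flat TRANSPORT (B4β) `ND.transportRound` of SPEC `Cruxes/EquisingularLiftNatThree/NewtonNondegenerateRungK5.lean`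
§13.13: ONE `ND.StrataTower` step (blow-up of a stratum, stepped boundary, set-theoretic strict transform of `T`) base-changes along a FLAT morphism of bases with
compatible boundary, and — by induction over the derivation — whole strata towers PULL BACK along flat morphisms (§4 (A)) and EXTEND from a flat sub-base that carries the
supports of the non-frame divisors (§4 (B), the centres being global strata: `exists_isBlowup` + uniqueness of blow-ups). Tools: `IsBlowup.of_isPullback_of_flat`
(Literature `BlowupsFlatBaseChange`, GW Prop. 13.91 (2)), `comap_strictTransformIdeal_of_flat` (Literature `MarkedIdealsEtale`), `Flat.generalizingMap` (Mathlib) with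
`Scheme.exists_mem_specializes_of_mem_closure` (tree, `…CampaignW45bULTHorizontalBridge`) for «preimage of a closure = closure of the preimage» along flat maps.
-/

set_option linter.dupNamespace false

noncomputable section

open CategoryTheory CategoryTheory.Limits AlgebraicGeometry TopologicalSpace Topology
open Literature.AlgebraicGeometry.Resolution
open AlgebraicGeometry.Scheme.IdealSheafData

namespace Summit.ResolutionOfSingularities.ResolutionOfSingularities.Cruxes.EquisingularLiftNat.Sections.ND

variable {n : ℕ}

/-! ## §1 Boundaries, strata and stepped boundaries under `IdealSheafData.comap` -/

/-- The stratum of a face commutes with pulling the boundary back along any morphism: `(τ.sup E)·𝒪_G = τ.sup (E·𝒪_G)`.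
[OURS · (B4β1) plumbing; `comap_sup`] -/
theorem stratum_comap {F G : Scheme.{0}} (E : Boundary n F) (g : G ⟶ F) (τ : Finset (Ray n)) :
    stratum (fun ρ => (E ρ).comap g) τ = (stratum E τ).comap g := by
  classical
  unfold stratum
  induction τ using Finset.induction_on with
  | empty => simp
  | insert ρ τ hρ ih => rw [Finset.sup_insert, Finset.sup_insert, ih, comap_sup]

/-- The support of the pulled-back stratum is the preimage of the support. [OURS · (B4β1) plumbing; `support_comap`] -/
theorem coe_support_stratum_comap {F G : Scheme.{0}} (E : Boundary n F) (g : G ⟶ F) (τ : Finset (Ray n)) :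
    ((stratum (fun ρ => (E ρ).comap g) τ).support : Set G) = g ⁻¹' ((stratum E τ).support : Set F) := by
  rw [stratum_comap, support_comap]
  rfl

/-- The frame boundary commutes with pulling the frame back along any morphism. [OURS · (B4β1) plumbing] -/
theorem frameBoundary_comap {F G : Scheme.{0}} (W : Fin n → F.IdealSheafData) (g : G ⟶ F) :
    frameBoundary (fun j => (W j).comap g) = fun ρ => (frameBoundary W ρ).comap g := by
  funext ρ
  by_cases hρ : ρ ∈ Set.range (e n)
  · obtain ⟨j, rfl⟩ := hρ
    rw [frameBoundary_e, frameBoundary_e]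
  · rw [frameBoundary_of_not_mem_range _ hρ, frameBoundary_of_not_mem_range _ hρ, comap_top]

/-- **The stepped boundary commutes with flat base change**: for a commutative square `g' ≫ υ = υG ≫ g` with `g'` flat between locally Noetherian schemes
(e.g. the cartesian square of the blow-ups of `F` along `C` and of `G` along `C·𝒪_G` over a flat `g`), pulling `E.stepAlong C ν υ` back along `g'` is stepping
the pulled-back boundary along `C·𝒪_G` and `υG` (new ray: total transforms compose; other rays: strict transforms commute with flat base change,
`comap_strictTransformIdeal_of_flat`). [OURS · (B4β1)] -/
theorem stepAlong_comap_of_flat {F F' G G' : Scheme.{0}} [IsLocallyNoetherian F'] [IsLocallyNoetherian G']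
    (E : Boundary n F) (C : F.IdealSheafData) (ν : Ray n) (υ : F' ⟶ F) (g : G ⟶ F) (g' : G' ⟶ F') (υG : G' ⟶ G) [Flat g']
    (hsq : g' ≫ υ = υG ≫ g) :
    (fun ρ => (E.stepAlong C ν υ ρ).comap g') = Boundary.stepAlong (fun ρ => (E ρ).comap g) (C.comap g) ν υG := by
  funext ρ
  by_cases h : ρ = ν
  · subst h
    rw [stepAlong_self, stepAlong_self, ← comap_comp, hsq, comap_comp]
  · rw [stepAlong_of_ne _ _ h, stepAlong_of_ne _ _ h]
    exact comap_strictTransformIdeal_of_flat g hsq C (E ρ)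

/-! ## §2 The blow-up of a stratum under flat base change -/

/-- **The blow-up of a stratum base-changes to the blow-up of the pulled-back stratum** along a flat `g` (GW Prop. 13.91 (2) `IsBlowup.of_isPullback_of_flat`
+ `stratum_comap`). [OURS · (B4β1)] -/
theorem isBlowup_stratum_comap_of_isPullback {F F' G G' : Scheme.{0}} (E : Boundary n F) (τ : Finset (Ray n))
    {υ : F' ⟶ F} {g : G ⟶ F} {g' : G' ⟶ F'} {υG : G' ⟶ G} [Flat g] (H : IsPullback g' υG υ g)
    (hυ : IsBlowup υ (stratum E τ)) : IsBlowup υG (stratum (fun ρ => (E ρ).comap g) τ) := by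
  rw [stratum_comap]
  exact hυ.of_isPullback_of_flat H

/-! ## §3 Closures of preimages along flat (generalizing) morphisms -/

/-- **Along a generalizing continuous map into a locally Noetherian scheme, the preimage of the closure of a locally closed set is the closure of its preimage**
(going-down: a point of the closure is a specialisation of a point of the set, which lifts). Flat morphisms are generalizing (`Flat.generalizingMap`).
[folklore; OURS · (B4β1) plumbing] -/
theorem preimage_closure_eq_closure_preimage_of_generalizingMap {X Y : Scheme.{0}} [IsLocallyNoetherian Y] (f : X ⟶ Y)
    (hf : GeneralizingMap f.base) {S : Set Y} (hS : IsLocallyClosed S) : f ⁻¹' closure S = closure (f ⁻¹' S) := by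
  refine Set.Subset.antisymm (fun x hx => ?_) (f.continuous.closure_preimage_subset S)
  obtain ⟨c, hcS, hcx⟩ :=
    Summit.ResolutionOfSingularities.ResolutionOfSingularities.Theorems.EquisingularLift.Scheme.exists_mem_specializes_of_mem_closure hS hx
  obtain ⟨x', hx'x, hx'c⟩ := hf hcx
  exact Summit.ResolutionOfSingularities.ResolutionOfSingularities.Theorems.EquisingularLift.mem_closure_of_mem_specializes
    (S := f ⁻¹' S) (show f x' ∈ S by rw [hx'c]; exact hcS) hx'x

/-- **The set-theoretic strict transform commutes with flat base change**: for a commutative square `g' ≫ υ = υG ≫ g` with `g'` flat and `F'` locally Noetherian,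
and closed `T`, `D` on `F`, `g'⁻¹ cl(υ⁻¹(T ∖ D)) = cl(υG⁻¹(g⁻¹T ∖ g⁻¹D))`. [OURS · (B4β1)] -/
theorem preimage_closure_preimage_diff_of_flat {F F' G G' : Scheme.{0}} [IsLocallyNoetherian F'] {υ : F' ⟶ F} {g : G ⟶ F} {g' : G' ⟶ F'}
    {υG : G' ⟶ G} [Flat g'] (hsq : g' ≫ υ = υG ≫ g) {T D : Set F} (hT : IsClosed T) (hD : IsClosed D) :
    g' ⁻¹' closure (υ ⁻¹' (T \ D)) = closure (υG ⁻¹' (g ⁻¹' T \ g ⁻¹' D)) := by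
  have hlc : IsLocallyClosed (υ ⁻¹' (T \ D)) := by
    rw [Set.sdiff_eq]
    exact ((hT.isLocallyClosed.inter hD.isOpen_compl.isLocallyClosed)).preimage υ.continuous
  rw [preimage_closure_eq_closure_preimage_of_generalizingMap g' (Flat.generalizingMap g') hlc]
  congr 1
  ext x
  have hpt : υ (g' x) = g (υG x) := by
    rw [← Scheme.Hom.comp_apply, hsq, Scheme.Hom.comp_apply]
  simp only [Set.mem_preimage, Set.mem_sdiff, hpt]

/-- The support of a stratum with a member `ρ ∈ τ` lies inside the support of `E ρ` (`E ρ ≤ τ.sup E` and `support` is antitone). [OURS · plumbing] -/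
theorem coe_support_stratum_subset {F : Scheme.{0}} (E : Boundary n F) {τ : Finset (Ray n)} {ρ : Ray n} (hρ : ρ ∈ τ) :
    ((stratum E τ).support : Set F) ⊆ ((E ρ).support : Set F) :=
  support_antitone (Finset.le_sup (f := E) hρ)

/-! ## §4 Strata towers under flat base change: the strict-transform set shrinks; (A) PULL-BACK along a flat morphism; (B) EXTENSION from a flat sub-base -/

/-- Along a strata tower the strict-transform set only shrinks: `T₉ ⊆ β⁻¹ cl(T)`. [OURS · plumbing] -/
theorem StrataTower.subset_preimage_closure {F : Scheme.{0}} {E : Boundary n F} {T : Set F} {F₉ : Scheme.{0}} {β : F₉ ⟶ F}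
    {T₉ : Set F₉} (h : StrataTower F E T F₉ β T₉) : T₉ ⊆ β ⁻¹' closure T := by
  induction h with
  | nil F E T =>
    intro t ht
    simpa using subset_closure ht
  | cons F E T τ hτ hE1 hT F' υ hυ F₉ β T₉ hrest ih =>
    intro t ht
    have h1 := ih ht
    rw [Set.mem_preimage, closure_closure] at h1
    have h2 : closure (υ ⁻¹' (T \ ((stratum E τ).support : Set F))) ⊆ υ ⁻¹' closure T :=
      closure_minimal ((Set.preimage_mono Set.sdiff_subset).trans (Set.preimage_mono subset_closure))
        (isClosed_closure.preimage υ.continuous)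
    rw [Set.mem_preimage, Scheme.Hom.comp_apply]
    exact h2 h1

/-- **(A) STRATA TOWERS PULL BACK ALONG FLAT MORPHISMS.** A strata tower over `(F, E, T)` (`F` locally Noetherian, `T` closed) and a flat `g : G ⟶ F` from a locally
Noetherian `G` such that some point of the top strict-transform set `T₉` lies over a point in the image of `g` give a strata tower over `(G, E·𝒪_G, g⁻¹T)` whose
top is a fibre product `G₉ = G ×_F F₉` (SOME cartesian square `g₉ ≫ β = βG ≫ g`) with strict-transform set `g₉⁻¹T₉`: the same faces, each step the flat base change
of the corresponding step over `F` (§1–§3). The nonemptiness hypothesis is exactly what keeps every base-changed step E1-legal (`T ⊄ centre`). Induction over the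
derivation. [OURS · (B4β1)] -/
theorem StrataTower.baseChange_of_flat {F : Scheme.{0}} {E : Boundary n F} {T : Set F} {F₉ : Scheme.{0}} {β : F₉ ⟶ F} {T₉ : Set F₉}
    (h : StrataTower F E T F₉ β T₉) :
    ∀ (_ : IsLocallyNoetherian F) (_ : IsClosed T) {G : Scheme.{0}} (g : G ⟶ F) [Flat g] [IsLocallyNoetherian G],
      (∃ t ∈ T₉, ∃ s : G, g s = β t) →
      ∃ (G₉ : Scheme.{0}) (βG : G₉ ⟶ G) (g₉ : G₉ ⟶ F₉), IsPullback g₉ βG β g ∧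
        StrataTower G (fun ρ => (E ρ).comap g) (g ⁻¹' T) G₉ βG (g₉ ⁻¹' T₉) := by
  induction h with
  | nil F E T =>
    intro _ _ G g _ _ _
    exact ⟨G, 𝟙 G, g, IsPullback.of_id_snd, StrataTower.nil G _ _⟩
  | cons F E T τ hτ hE1 hT F' υ hυ F₉ β T₉ hrest ih =>
    intro hF hTcl G g _ hG hne
    haveI := hF
    haveI : IsProper υ := hυ.isProper
    haveI : IsLocallyNoetherian F' := LocallyOfFiniteType.isLocallyNoetherian υ
    -- the base change of the first step
    have H : IsPullback (pullback.fst υ g) (pullback.snd υ g) υ g := IsPullback.of_hasPullback υ g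
    haveI : Flat (pullback.fst υ g) := MorphismProperty.of_isPullback H.flip ‹Flat g›
    haveI : IsProper (pullback.snd υ g) := MorphismProperty.of_isPullback H ‹IsProper υ›
    haveI : IsLocallyNoetherian (pullback υ g : Scheme.{0}) := LocallyOfFiniteType.isLocallyNoetherian (pullback.snd υ g)
    have hυG : IsBlowup (pullback.snd υ g) (stratum (fun ρ => (E ρ).comap g) τ) := isBlowup_stratum_comap_of_isPullback E τ H hυ
    have hE1G : ((stratum (fun ρ => (E ρ).comap g) τ).support : Set G) ⊆ g ⁻¹' T := by
      rw [coe_support_stratum_comap]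
      exact Set.preimage_mono hE1
    have hTq : (pullback.fst υ g) ⁻¹' closure (υ ⁻¹' (T \ ((stratum E τ).support : Set F))) =
        closure ((pullback.snd υ g) ⁻¹' (g ⁻¹' T \ ((stratum (fun ρ => (E ρ).comap g) τ).support : Set G))) := by
      rw [coe_support_stratum_comap]
      exact preimage_closure_preimage_diff_of_flat H.w hTcl (stratum E τ).support.isClosed
    -- a point of `T₉` over the image of `g` gives a point of the base-changed first stage over the image of `pullback.fst`
    obtain ⟨t, htT₉, s, hs⟩ := hne
    obtain ⟨z, hz1, hz2⟩ := Scheme.Pullback.exists_preimage_pullback (f := υ) (g := g) (β t) s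
      (by rw [hs, Scheme.Hom.comp_apply])
    have hne' : ∃ t ∈ T₉, ∃ s' : (pullback υ g : Scheme.{0}), (pullback.fst υ g) s' = β t := ⟨t, htT₉, z, hz1⟩
    -- E1-legality of the base-changed step: otherwise its strict-transform set is empty, yet `z` lies in it
    have hTG : ¬ g ⁻¹' T ⊆ ((stratum (fun ρ => (E ρ).comap g) τ).support : Set G) := by
      intro hsub
      have hzT' : z ∈ (pullback.fst υ g) ⁻¹' closure (υ ⁻¹' (T \ ((stratum E τ).support : Set F))) := by
        rw [Set.mem_preimage, hz1]
        have := hrest.subset_preimage_closure htT₉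
        rwa [Set.mem_preimage, closure_closure] at this
      rw [hTq, Set.sdiff_eq_empty.mpr hsub, Set.preimage_empty, closure_empty] at hzT'
      exact hzT'
    -- recurse along the flat `pullback.fst`
    obtain ⟨G₉, βG', g₉, Hsq, htower⟩ := ih ‹IsLocallyNoetherian F'› isClosed_closure (pullback.fst υ g) hne'
    refine ⟨G₉, βG' ≫ pullback.snd υ g, g₉, Hsq.paste_vert H, ?_⟩
    have hEq : (fun ρ => ((E.stepAlong (stratum E τ) (∑ ρ ∈ τ, ρ) υ) ρ).comap (pullback.fst υ g)) =
        Boundary.stepAlong (fun ρ => (E ρ).comap g) (stratum (fun ρ => (E ρ).comap g) τ) (∑ ρ ∈ τ, ρ) (pullback.snd υ g) := by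
      rw [stepAlong_comap_of_flat E (stratum E τ) _ υ g (pullback.fst υ g) (pullback.snd υ g) H.w, stratum_comap]
    rw [hEq, hTq] at htower
    exact StrataTower.cons G _ (g ⁻¹' T) τ hτ hE1G hTG _ (pullback.snd υ g) hυG G₉ βG' (g₉ ⁻¹' T₉) htower

/-- **(B) STRATA TOWERS EXTEND FROM A FLAT SUB-BASE CARRYING THE NON-FRAME DIVISORS.** Let `g : G ⟶ F` be flat between locally Noetherian schemes, `E` a boundary on `F`
whose NON-FRAME members have support inside the image of `g`, and `T ⊆ F` closed. Then every strata tower over `(G, E·𝒪_G, g⁻¹T)` is the base change of a strata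
tower over `(F, E, T)` with the SAME faces: at each step blow up the GLOBAL stratum on `F` (`exists_isBlowup`); its base change is a blow-up of the pulled-back stratum,
hence (uniqueness of blow-ups) isomorphic over `G` to the given step; legality descends because the centre lies in the image of `g`; the hypotheses reproduce
themselves (§1–§3, `comap_le_strictTransformIdeal`). Output: the tower over `F`, a cartesian square `g₉ ≫ β = βG ≫ g` at the top, and `TG₉ = g₉⁻¹T₉`.
Use ((B4β) transport): `G = Spec 𝒪_{F₁,x} ×_{F₁} F₂ ⟶ F₂`, the exceptional rays lying over `x`. Induction over the derivation. [OURS · (B4β1)] -/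
theorem StrataTower.extend_of_flat {G : Scheme.{0}} {EG : Boundary n G} {TG : Set G} {G₉ : Scheme.{0}} {βG : G₉ ⟶ G} {TG₉ : Set G₉}
    (h : StrataTower G EG TG G₉ βG TG₉) :
    ∀ {F : Scheme.{0}} (_ : IsLocallyNoetherian F) (_ : IsLocallyNoetherian G) (E : Boundary n F) (T : Set F) (_ : IsClosed T)
      (g : G ⟶ F) [Flat g], EG = (fun ρ => (E ρ).comap g) → TG = g ⁻¹' T →
      (∀ ρ, ρ ∉ Set.range (e n) → ((E ρ).support : Set F) ⊆ Set.range g) →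
      ∃ (F₉ : Scheme.{0}) (β : F₉ ⟶ F) (T₉ : Set F₉) (g₉ : G₉ ⟶ F₉), IsPullback g₉ βG β g ∧
        StrataTower F E T F₉ β T₉ ∧ TG₉ = g₉ ⁻¹' T₉ := by
  induction h with
  | nil G EG TG =>
    intro F _ _ E T _ g _ _ hT _
    exact ⟨F, 𝟙 F, T, g, IsPullback.of_id_snd, StrataTower.nil F E T, hT⟩
  | cons G EG TG τ hτ hE1G hTG G' υG hυG G₉ βG TG₉ hrest ih =>
    intro F hF hG E T hTcl g _ hE hT hfull
    subst hE hT
    haveI := hF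
    haveI := hG
    -- a non-frame ray of `τ`: the centre lies in the image of `g`
    obtain ⟨ρ₀, hρ₀τ, hρ₀⟩ := hτ
    have hCfull : ((stratum E τ).support : Set F) ⊆ Set.range g := (coe_support_stratum_subset E hρ₀τ).trans (hfull ρ₀ hρ₀)
    -- legality descends to `F`
    rw [coe_support_stratum_comap] at hE1G hTG
    have hE1 : ((stratum E τ).support : Set F) ⊆ T := by
      intro c hc
      obtain ⟨s, rfl⟩ := hCfull hc
      exact hE1G hc
    have hT : ¬ T ⊆ ((stratum E τ).support : Set F) := fun hsub => hTG (Set.preimage_mono hsub)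
    -- blow up the global stratum on `F`; its base change is a blow-up of the pulled-back stratum, hence isomorphic to the given step
    obtain ⟨F', υ, hυ⟩ := exists_isBlowup F (stratum E τ)
    haveI : IsProper υ := hυ.isProper
    haveI : IsLocallyNoetherian F' := LocallyOfFiniteType.isLocallyNoetherian υ
    have hP : IsBlowup (pullback.snd υ g) (stratum (fun ρ => (E ρ).comap g) τ) :=
      isBlowup_stratum_comap_of_isPullback E τ (IsPullback.of_hasPullback υ g) hυ
    obtain ⟨eI, he, -⟩ := hυG.unique hP
    let g' : G' ⟶ F' := eI.hom ≫ pullback.fst υ g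
    have H : IsPullback g' υG υ g := by
      refine IsPullback.of_iso_pullback ⟨?_⟩ eI rfl he
      rw [Category.assoc, pullback.condition, ← Category.assoc, he]
    haveI : Flat g' := MorphismProperty.of_isPullback H.flip ‹Flat g›
    haveI : IsProper υG := MorphismProperty.of_isPullback H ‹IsProper υ›
    haveI : IsLocallyNoetherian G' := LocallyOfFiniteType.isLocallyNoetherian υG
    -- the hypotheses at the next stage
    have hEq : Boundary.stepAlong (fun ρ => (E ρ).comap g) (stratum (fun ρ => (E ρ).comap g) τ) (∑ ρ ∈ τ, ρ) υG =
        (fun ρ => ((E.stepAlong (stratum E τ) (∑ ρ ∈ τ, ρ) υ) ρ).comap g') := by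
      rw [stepAlong_comap_of_flat E (stratum E τ) _ υ g g' υG H.w, stratum_comap]
    have hTq : closure (υG ⁻¹' (g ⁻¹' T \ ((stratum (fun ρ => (E ρ).comap g) τ).support : Set G))) =
        g' ⁻¹' closure (υ ⁻¹' (T \ ((stratum E τ).support : Set F))) := by
      rw [coe_support_stratum_comap]
      exact (preimage_closure_preimage_diff_of_flat H.w hTcl (stratum E τ).support.isClosed).symm
    have hrange : Set.range g' = υ ⁻¹' Set.range g := by
      have h1 : Set.range g' = Set.range (pullback.fst υ g) := by
        change Set.range ((eI.hom ≫ pullback.fst υ g : G' ⟶ F') : G' → F') = _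
        rw [Scheme.Hom.comp_base, TopCat.coe_comp,
          Set.range_comp, Set.range_eq_univ.mpr (ConcreteCategory.bijective_of_isIso eI.hom.base).2, Set.image_univ]
      rw [h1, Scheme.Pullback.range_fst]
    have hfull' : ∀ ρ, ρ ∉ Set.range (e n) →
        (((E.stepAlong (stratum E τ) (∑ ρ ∈ τ, ρ) υ) ρ).support : Set F') ⊆ Set.range g' := by
      intro ρ hρ
      rw [hrange]
      by_cases hν : ρ = ∑ ρ ∈ τ, ρ
      · rw [hν, stepAlong_self, support_comap]
        exact Set.preimage_mono hCfull
      · rw [stepAlong_of_ne _ _ hν]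
        have hle : ((strictTransformIdeal υ (stratum E τ) (E ρ)).support : Set F') ⊆ (((E ρ).comap υ).support : Set F') :=
          support_antitone (comap_le_strictTransformIdeal υ (stratum E τ) (E ρ))
        refine hle.trans ?_
        rw [support_comap]
        exact Set.preimage_mono (hfull ρ hρ)
    -- recurse
    obtain ⟨F₉, β', T₉, g₉, Hsq, htower, hT₉⟩ :=
      ih ‹IsLocallyNoetherian F'› ‹IsLocallyNoetherian G'› (E.stepAlong (stratum E τ) (∑ ρ ∈ τ, ρ) υ)
        (closure (υ ⁻¹' (T \ ((stratum E τ).support : Set F)))) isClosed_closure g' hEq hTq hfull'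
    exact ⟨F₉, β' ≫ υ, T₉, g₉, Hsq.paste_vert H,
      StrataTower.cons F E T τ ⟨ρ₀, hρ₀τ, hρ₀⟩ hE1 hT F' υ hυ F₉ β' T₉ htower, hT₉⟩

end Summit.ResolutionOfSingularities.ResolutionOfSingularities.Cruxes.EquisingularLiftNat.Sections.ND

end
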